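import Literature.Barriers.NavierStokesRegularity.SchefferSwitchedPieces
import Literature.Barriers.NavierStokesRegularity.NavierStokesInequalityArrangementConclusion
import Summits.NavierStokesRegularity.NavierStokesRegularity.Theses.TypeILiouville
import HarnessLib

/-!
# Negative-lane seed for «suitability is rate-blind»: the super-self-similar NSI cascade

Support file (`--supports stmt-NavierStokesRegularity-0056`, the residual `NoTypeII` of the
Type-I Liouville door) recording, as kernel-checked lemmas, the two load-bearing ingredients of
critic-1's K-READ 03 counterexample to the §B candidate «`NSIFirstBlowupIsTypeI`: first-time
blow-ups of weak solutions of the Navier–Stokes INEQUALITY are Type I» (HOME bus,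
`ns-typeII-critic-1/KREAD-03-NSIFirstBlowupIsTypeI.md`):

* `printed_constants_margin` — **the printed block has super-similar gain.** With the constants
  of W. S. Ożański, arXiv:1709.00602, §5.5 ((5.16) `τ = 0.48ε`, (5.30) `‖f₁‖_∞ ≤ μ/100`,
  `μ > 100`, (5.31) `T = (μ² - 5)/(1.1ε²B)`; tree: `printed_constants`) the two numerical
  hypotheses behind the gain inequality (4.2) hold with the constant `τ⁻²` replaced by
  `(6/5)² τ⁻²`: `(6/5)²τ⁻²(μ/100 + μ)² < 8TB` and `(6/5)²τ⁻²(μ/100)² < 0.01TB` (printed slack: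
  `8TB ≥ (7.2/1.1)(μ/ε)²` against `(1.01/0.48)²(μ/ε)²`, ratio `1.478`; Case 2 ratio `18.8`).
  Feeding these into the (verbatim) §4 argument gives a classical block whose gain of magnitude is
  `|u(Γx,T)| ≥ (6/5)τ⁻¹|u(x,0)|` while its similarity ratio stays `τ`.
* `nsi_superPiece` — **two-parameter covariance of the pointwise Navier–Stokes
  inequality.** For a classical block `u` (pointwise NSI for every `ν ∈ [0,ν₀]`), amplitude
  `a > 0`, space ratio `b > 0` with `b ≤ a`, and time ratio `ab`, the rescaled field
  `w(s,y) = a·u(t₀ + ab·s, x₁ + b·y)` satisfies the pointwise NSI at viscosity `ν ∈ [0,ν₀]`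
  (because `u` satisfies it at the effective viscosity `νb/a ≤ ν`). With `a = b = τ⁻ʲ` this is
  the tree's `IsNSIBlock.nsi_piece`; with `a = (6/5)ʲτ⁻ʲ > b = τ⁻ʲ` it is the `j`-th piece of
  the super-self-similar cascade, whose switched field is a weak NSI solution (gluing principle
  `isWeakNSISolution_of_piecewise`) with `(T₀ - t)^{1/2}‖𝔲(t)‖_∞ → ∞`, i.e. a TYPE-II blow-up
  inside the NSI class.

Neither lemma asserts a Theses statement; both are negative-lane support (D-0016) for the
barrier reading of `NoTypeII`: any Type-II exclusion proved from ⟨energy class, local energy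
inequality with defect, Riesz pressure law, divergence-free, smoothness before `T`, compact
support⟩ alone is contradicted by the cascade.

## References

* W. S. Ożański, *On weak solutions to the Navier–Stokes inequality with internal
  singularities*, arXiv:1709.00602 (2017), §2 (2.4), §4, §5.5 (5.16), (5.29)–(5.31).
  [`Ozanski2017NSISingular`]
* V. Scheffer, Comm. Math. Phys. 101 (1985), 47–85, Lemma 2.3. [`Scheffer1985`]
-/

noncomputable section

open MeasureTheory Set Function Filter Topology
open scoped InnerProductSpace RealInnerProductSpace ContDiff Laplacian

set_option linter.dupNamespace false

namespace Summit.NavierStokesRegularity.NavierStokesRegularity.Theorems.TypeIliouvilleNoTypeIINegative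

open Literature.Analysis.FluidPDE Literature.Barriers.NavierStokesRegularity

/-! ### The printed constants leave a gain margin `K = 6/5` -/

/-- **The printed constants of Ożański 2017, §5.5 admit the gain constant `(6/5)τ⁻¹`**: with
`τ = 0.48ε`, `μ > 100`, `T = (μ² - 5)/(1.1ε²B)` (`ε, B > 0`): `4 + 1.1ε²BT < μ²` ((4.1)),
`(6/5)² τ⁻²(μ/100 + μ)² < 8TB` (Case 1 of (5.29) with margin) and
`(6/5)² τ⁻²(μ/100)² < 0.01TB` (Case 2 with margin). Compare `printed_constants` (margin `1`).
[cite: Ozanski2017NSISingular, §5.5 (5.29)–(5.31)] -/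
theorem printed_constants_margin {ε μ B T τ : ℝ} (hε : 0 < ε) (hB : 0 < B) (hμ : 100 < μ)
    (hT : T = (μ ^ 2 - 5) / (11 / 10 * ε ^ 2 * B)) (hτ : τ = 48 / 100 * ε) :
    4 + T * (11 / 10 * ε ^ 2 * B) < μ ^ 2 ∧
      (6 / 5) ^ 2 * (τ⁻¹ ^ 2 * (μ / 100 + μ) ^ 2) < T * (8 * B) ∧
      (6 / 5) ^ 2 * (τ⁻¹ ^ 2 * (μ / 100) ^ 2) < T * (B / 100) := by
  have hε2 : 0 < ε ^ 2 := by positivity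
  have hμ2 : 10000 < μ ^ 2 := by nlinarith
  have hden : 0 < 11 / 10 * ε ^ 2 * B := by positivity
  have hTL : T * (11 / 10 * ε ^ 2 * B) = μ ^ 2 - 5 := by
    rw [hT, div_mul_cancel₀ _ hden.ne']
  have hτinv : τ⁻¹ ^ 2 = (100 / 48) ^ 2 / ε ^ 2 := by
    rw [hτ, inv_pow, mul_pow]; field_simp
  refine ⟨by linarith, ?_, ?_⟩
  · have h8 : T * (8 * B) = 80 / 11 * (μ ^ 2 - 5) / ε ^ 2 := by
      rw [hT]; field_simp; ring
    have e : (6 / 5 : ℝ) ^ 2 * ((100 / 48) ^ 2 / ε ^ 2 * (μ / 100 + μ) ^ 2) =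
        (6 / 5) ^ 2 * (100 / 48) ^ 2 * (μ / 100 + μ) ^ 2 / ε ^ 2 := by ring
    rw [hτinv, h8, e, div_lt_div_iff_of_pos_right hε2]
    nlinarith
  · have h01 : T * (B / 100) = 1 / 110 * (μ ^ 2 - 5) / ε ^ 2 := by
      rw [hT]; field_simp; ring
    have e : (6 / 5 : ℝ) ^ 2 * ((100 / 48) ^ 2 / ε ^ 2 * (μ / 100) ^ 2) =
        (6 / 5) ^ 2 * (100 / 48) ^ 2 * (μ / 100) ^ 2 / ε ^ 2 := by ring
    rw [hτinv, h01, e, div_lt_div_iff_of_pos_right hε2]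
    nlinarith

/-! ### Two-parameter covariance of the pointwise Navier–Stokes inequality -/

/-- **Two-parameter covariance of the pointwise Navier–Stokes inequality with a change of
viscosity.** If `u` is a classical NSI block (`IsNSIBlock`: pointwise
`∂ₜ|u|² ≤ -u·∇(|u|² + 2p̃[u]) + 2ν' u·Δu` on `[0,T] × ℝ³` for every `ν' ∈ [0,ν₀]`), `0 < b ≤ a`,
`ν ∈ [0, ν₀]`, and the local time `σ = t₀ + ab·s` lies in `[0,T]`, then the super-self-similar
piece `w = a • stPull (ab) b t₀ x₁ u`, `w(s,y) = a · u(t₀ + ab·s, x₁ + b·y)`, satisfies the pointwise NSI at viscosity `ν` at `(s, x)`: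
every term of the inequality for `w` is `a³b` times the corresponding term for `u` at
`(σ, x₁ + bx)` with viscosity `νb/a ∈ [0, ν₀]`. (`a = b`: Ożański 2017, §2, the rescaled copies
"satisfy the NSI"; `a > b`: the pieces of the super-self-similar cascade.)
[cite: Ozanski2017NSISingular, §2 (2.4)] -/
theorem nsi_superPiece
    {T ν₀ τ : ℝ} {z : EuclideanSpace ℝ (Fin 3)} {G : Set (EuclideanSpace ℝ (Fin 3))}
    {u : ℝ → EuclideanSpace ℝ (Fin 3) → EuclideanSpace ℝ (Fin 3)}
    (h : IsNSIBlock T ν₀ τ z G u) {a b : ℝ} (ha : 0 < a) (hb : 0 < b) (hba : b ≤ a)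
    {ν : ℝ} (hν : ν ∈ Icc 0 ν₀) (t₀ : ℝ) (x₁ : EuclideanSpace ℝ (Fin 3)) {s : ℝ}
    (hs : t₀ + a * b * s ∈ Icc 0 T) (x : EuclideanSpace ℝ (Fin 3)) :
    timeDeriv (fun r y => ‖(a • stPull (a * b) b t₀ x₁ u) r y‖ ^ 2) s x ≤
      -⟪(a • stPull (a * b) b t₀ x₁ u) s x, gradient (fun y => ‖(a • stPull (a * b) b t₀ x₁ u) s y‖ ^ 2 +
          2 * normalisedPressure ((a • stPull (a * b) b t₀ x₁ u) s) y) x⟫ +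
        2 * ν * ⟪(a • stPull (a * b) b t₀ x₁ u) s x, Δ ((a • stPull (a * b) b t₀ x₁ u) s) x⟫ := by
  -- abbreviations
  set θ : ℝ := a * b with hθ
  have hθpos : 0 < θ := mul_pos ha hb
  set σ : ℝ := t₀ + θ * s with hσdef
  set y : EuclideanSpace ℝ (Fin 3) := x₁ + b • x with hydef
  have hσ : σ ∈ Icc 0 T := hs
  -- the effective viscosity `ν b / a ∈ [0, ν₀]`
  have hν' : ν * b / a ∈ Icc 0 ν₀ := by
    refine ⟨div_nonneg (mul_nonneg hν.1 hb.le) ha.le, le_trans ?_ hν.2⟩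
    rw [div_le_iff₀ ha]
    exact mul_le_mul_of_nonneg_left hba hν.1
  -- the block inequality at `(σ, y)` with viscosity `ν b / a`
  have hblock := h.nsi (ν * b / a) hν' σ hσ y
  -- regularity of the slice `u σ` and of its pressure
  have huσ : ContDiff ℝ ∞ (u σ) := h.contDiff_slice hσ
  have hu2 : ContDiff ℝ 2 (u σ) := huσ.of_le (by norm_cast)
  have huc : HasCompactSupport (u σ) := h.hasCompactSupport_slice hσ
  have hp2 : ContDiff ℝ 2 (normalisedPressure (u σ)) :=
    contDiff_normalisedPressure_of_hasCompactSupport huσ huc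
  set Q : EuclideanSpace ℝ (Fin 3) → ℝ := fun w => ‖u σ w‖ ^ 2 + 2 * normalisedPressure (u σ) w
    with hQdef
  have hQd : Differentiable ℝ Q :=
    ((hu2.differentiable (by norm_num)).norm_sq ℝ).add
      ((hp2.differentiable (by norm_num)).const_mul 2)
  -- (1) the time derivative of `|w|²`
  have e1 : (fun r w => ‖(a • stPull θ b t₀ x₁ u) r w‖ ^ 2) =
      (a ^ 2) • stPull θ b t₀ x₁ (fun r w => ‖u r w‖ ^ 2) := by
    funext r w
    simp only [smul_stPull_apply, smul_eq_mul, norm_smul, Real.norm_eq_abs, mul_pow, sq_abs]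
  have hT : timeDeriv (fun r w => ‖(a • stPull θ b t₀ x₁ u) r w‖ ^ 2) s x =
      (a ^ 2 * θ) * timeDeriv (fun r w => ‖u r w‖ ^ 2) σ y := by
    rw [e1, timeDeriv_eq_timeDerivWithin_univ, timeDeriv_eq_timeDerivWithin_univ]
    have := timeDerivWithin_smul_stPull (univ : Set ℝ) (fun r w => ‖u r w‖ ^ 2) (a ^ 2)
      (β := θ) hθpos.ne' b t₀ x₁ s x
    rw [preimage_univ] at this
    rw [this, smul_eq_mul]
  -- (2) the gradient term
  have e2 : (fun w => ‖(a • stPull θ b t₀ x₁ u) s w‖ ^ 2 +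
      2 * normalisedPressure ((a • stPull θ b t₀ x₁ u) s) w) =
      fun w => (a ^ 2) • stPull θ b t₀ x₁ (fun (_ : ℝ) w' => Q w') s w := by
    have hp : ∀ w, normalisedPressure ((a • stPull θ b t₀ x₁ u) s) w =
        a ^ 2 * normalisedPressure (u σ) (x₁ + b • w) := by
      intro w
      have e : (a • stPull θ b t₀ x₁ u) s = fun y => a • u σ (x₁ + b • y) := by
        funext y; rfl
      rw [e]
      exact normalisedPressure_smul_comp_affine _ _ _ hb w
    funext w
    rw [hp w]
    simp only [smul_stPull_apply, stPull_apply, smul_eq_mul, norm_smul, Real.norm_eq_abs,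
      mul_pow, sq_abs, hQdef]
    ring
  have hG : gradient (fun w => ‖(a • stPull θ b t₀ x₁ u) s w‖ ^ 2 +
      2 * normalisedPressure ((a • stPull θ b t₀ x₁ u) s) w) x = (a ^ 2 * b) • gradient Q y := by
    rw [e2]
    have hd : DifferentiableAt ℝ (stPull θ b t₀ x₁ (fun (_ : ℝ) w' => Q w') s) x :=
      differentiable_stPull_slice (u := fun (_ : ℝ) w' => Q w') hQd x
    rw [gradient_const_smul hd, gradient_stPull, smul_smul]
  -- (3) the Laplacian
  have hL : Δ ((a • stPull θ b t₀ x₁ u) s) x = (a * b ^ 2) • Δ (u σ) y := by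
    have hu2' : ContDiffAt ℝ 2 (stPull θ b t₀ x₁ u s) x := (contDiff_stPull_slice hu2).contDiffAt
    rw [show (a • stPull θ b t₀ x₁ u) s = a • stPull θ b t₀ x₁ u s from rfl,
      InnerProductSpace.laplacian_smul a hu2', laplacian_stPull θ b t₀ x₁ u s x hu2, smul_smul]
  -- (4) the value
  have hV : (a • stPull θ b t₀ x₁ u) s x = a • u σ y := rfl
  -- assemble
  rw [hT, hG, hL, hV]
  simp only [inner_smul_left, inner_smul_right, RCLike.conj_to_real]
  have key : a ^ 2 * θ * timeDeriv (fun r w => ‖u r w‖ ^ 2) σ y ≤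
      a ^ 2 * θ * (-⟪u σ y, gradient Q y⟫ + 2 * (ν * b / a) * ⟪u σ y, Δ (u σ) y⟫) :=
    mul_le_mul_of_nonneg_left hblock (mul_nonneg (pow_nonneg ha.le 2) hθpos.le)
  have e3 : a ^ 2 * θ * (-⟪u σ y, gradient Q y⟫ + 2 * (ν * b / a) * ⟪u σ y, Δ (u σ) y⟫) =
      -(a ^ 2 * b * (a * ⟪u σ y, gradient Q y⟫)) +
        2 * ν * (a * b ^ 2 * (a * ⟪u σ y, Δ (u σ) y⟫)) := by
    rw [hθ]; field_simp
  rw [e3] at key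
  linarith [key]

end Summit.NavierStokesRegularity.NavierStokesRegularity.Theorems.TypeIliouvilleNoTypeIINegative

end
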